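import Summits.QuantumFields.YangMills.Theorems.AllWindowsColdBoxBoxHighLineTiltUSlots
import Summits.QuantumFields.YangMills.Theorems.AllWindowsColdBoxBoxHighLineTiltFourthMomentRecentre
import Summits.QuantumFields.YangMills.Theorems.AllWindowsColdBoxBoxHighLineTiltCum3Chart
import Summits.QuantumFields.YangMills.Theorems.AllWindowsColdBoxBoxHighLineSmallFieldInsideFPByName

/-!
# T-S5.13K-K3 — (e4) PACKAGED: the eight moment sizes plugged into LEAD's ✓`Tilt.abs_tiltCum3_muD_zero_chartPlaqCost_le`
# (ASSEMBLY-S5 §6 (e4), E2-memo step 4; LINE-19 S5 ⟨stmt-QuantumFields-24004⟩)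

`|κ₃,₀(c_x, c_y, tiltU)| ≤ T(Ẽ₁,Ẽ₂,Ũ_e) + T(Ẽ₁,O₂,U_o) + T(O₁,Ẽ₂,U_o) + T(O₁,O₂,Ũ_e)` (✓p744941), `T(X,Y,Z) = √(√E_0X⁴·√E_0Y⁴)·√E_0Z²` over
`μ_D := (volume.restrict (smallField H s)).withDensity (ofReal ∘ gaussWeight β H)`.  The sizes: `E_0[Ẽ⁴] ≤ A_E := C_E(1+log H)⁴/β⁴` and `E_0[O⁴] ≤ A_O := C_O s⁶/β³` (w4's
✓`Tilt.tiltExp_muD_zero_plaqCost_slots_le`, the E/O-slots in LEAD's letters incl. the `μ_D`-recentring), `E_0[Ũ_e²] ≤ Z_e := C_U(1+log H)^m(H⁸/β² + H¹²s⁶ + H⁸s⁸)`, `E_0[U_o²] ≤ Z_o := C_U(1+log H)^m(H⁴/β + H¹²s⁶ + H⁸s⁸)` (fcl-p3's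
✓`GaussNormalForm.tiltExp_muD_zero_tiltU_slots_le`).  Hence (free-hands seat ym-line-fcl-p3 g26)

  ★★ `abs_tiltCum3_muD_zero_chartPlaqCost_le_sizes`: with `L = 1 + log H`, `R = √(C_U L^m)`, `a_E = √C_E·L²/β²`, `a_O = √C_O·s³/(β√β)`,
  `P₈ = H⁴/β + H⁶s³ + H⁴s⁴`, `P₄ = H²/√β + H⁶s³ + H⁴s⁴`:
  `|κ₃,₀| ≤ a_E·R·P₈ + √(a_E·a_O)·R·P₄ + √(a_O·a_E)·R·P₄ + a_O·R·P₈` — the FOUR T-products kept SEPARATE (LEAD 21:26:12Z), `s` symbolic,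

for `H ≥ 1`, `β ≥ H⁴`, `0 < s ≤ 1`, `s·H² ≤ c₀`, `E₀[1_D] ≥ 1/2` (✓w3 `GaussTail.exists_beta0_half_le_gaussAvg_sfInd` in the §1 letters); the geometric means
`√(√A_E√A_O)` are kept (AM–GM there would cost `β^{1/2−3κ₃/2}`); `√Z` is opened termwise (`√(x+y+z) ≤ √x+√y+√z`).  The hypothesis `|tiltU| ≤ B` on `D` of ✓p744941 is discharged by w4's ✓`TiltSup.abs_tiltU_le`.

Mathlib + tree; no definitions.  HONEST LABEL: packaging for the OPEN assembly T-S5.13 of the XL stub S5 of a critic-PASSed DRAFT line; S5, U5, ⟨24004⟩ ⟨24335⟩ ⟨24336⟩ remain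
OPEN; route AllWindowsColdBox is DRAFT; no rung is proved; **the Yang–Mills mass gap is NOT proved by this file; no summit is proved by a line.**  Seat ym-line-fcl-p3 g26.
-/

set_option autoImplicit false

noncomputable section

open MeasureTheory
open Literature.Probability.LatticeModels (Site)
open Summit.QuantumFields.YangMills.Theorems.WeakCouplingRates (plaq12At)

namespace Summit.QuantumFields.YangMills.Theorems.AllWindowsColdBoxBoxHighLine

/-! ## §1 Small algebraic facts (clean context) -/

namespace GaussNormalForm

/-- `√(x + y + z) ≤ √x + (√y + √z)` for nonnegative reals (right-associated variant of the tree's `sqrt_add_three_le`). -/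
theorem sqrt_add_three_le' {x y z : ℝ} (hx : 0 ≤ x) (hy : 0 ≤ y) (hz : 0 ≤ z) : Real.sqrt (x + y + z) ≤ Real.sqrt x + (Real.sqrt y + Real.sqrt z) := by
  rw [Real.sqrt_le_iff]
  refine ⟨by positivity, ?_⟩
  have ex := Real.sq_sqrt hx
  have ey := Real.sq_sqrt hy
  have ez := Real.sq_sqrt hz
  nlinarith [Real.sqrt_nonneg x, Real.sqrt_nonneg y, Real.sqrt_nonneg z, mul_nonneg (Real.sqrt_nonneg x) (Real.sqrt_nonneg y),
    mul_nonneg (Real.sqrt_nonneg x) (Real.sqrt_nonneg z), mul_nonneg (Real.sqrt_nonneg y) (Real.sqrt_nonneg z)]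

/-- Monotonicity of LEAD's `T(X,Y,Z) = √(√a·√b)·√c` in the three moments. -/
theorem T_mono {a b c A B C : ℝ} (_ha : 0 ≤ a) (hab : a ≤ A) (_hb : 0 ≤ b) (hbB : b ≤ B) (_hc : 0 ≤ c) (hcC : c ≤ C) :
    Real.sqrt (Real.sqrt a * Real.sqrt b) * Real.sqrt c ≤ Real.sqrt (Real.sqrt A * Real.sqrt B) * Real.sqrt C := by
  refine mul_le_mul (Real.sqrt_le_sqrt (mul_le_mul (Real.sqrt_le_sqrt hab) (Real.sqrt_le_sqrt hbB) (Real.sqrt_nonneg _) (Real.sqrt_nonneg _)))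
    (Real.sqrt_le_sqrt hcC) (Real.sqrt_nonneg _) (Real.sqrt_nonneg _)

/-- `√(√a·√a) = √a`. -/
theorem sqrt_sqrt_mul_self {a : ℝ} (ha : 0 ≤ a) : Real.sqrt (Real.sqrt a * Real.sqrt a) = Real.sqrt a := by
  rw [Real.mul_self_sqrt ha]

/-- `√(K·u⁴/β⁴) = √K·u²/β²` (`u ≥ 0`, `β > 0`). -/
theorem sqrt_const_mul_pow_four_div {K u β : ℝ} (hK : 0 ≤ K) (_hu : 0 ≤ u) (hβ : 0 < β) :
    Real.sqrt (K * u ^ 4 / β ^ 4) = Real.sqrt K * u ^ 2 / β ^ 2 := by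
  have e : K * u ^ 4 / β ^ 4 = K * (u ^ 2 / β ^ 2) ^ 2 := by field_simp
  rw [e, Real.sqrt_mul hK, Real.sqrt_sq (by positivity)]
  ring

/-- `√(K·s⁶/β³) = √K·s³/(β·√β)` (`s ≥ 0`, `β > 0`). -/
theorem sqrt_const_mul_pow_six_div_cube {K s β : ℝ} (hK : 0 ≤ K) (hs : 0 ≤ s) (hβ : 0 < β) :
    Real.sqrt (K * s ^ 6 / β ^ 3) = Real.sqrt K * s ^ 3 / (β * Real.sqrt β) := by
  have hsb : 0 < Real.sqrt β := Real.sqrt_pos.2 hβ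
  have eβ : β * Real.sqrt β * (β * Real.sqrt β) = β ^ 3 := by
    have := Real.mul_self_sqrt hβ.le; nlinarith [this]
  have hpos : 0 < β * Real.sqrt β := by positivity
  rw [show K * s ^ 6 / β ^ 3 = K * (s ^ 3 / (β * Real.sqrt β)) ^ 2 by rw [div_pow, ← eβ]; ring, Real.sqrt_mul hK, Real.sqrt_sq (by positivity)]
  ring

/-- `√(H⁸/β² + H¹²s⁶ + H⁸s⁸) ≤ H⁴/β + H⁶s³ + H⁴s⁴` (`H, s ≥ 0`, `β > 0`). -/
theorem sqrt_X8_le {h s β : ℝ} (_hh : 0 ≤ h) (_hs : 0 ≤ s) (hβ : 0 < β) :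
    Real.sqrt (h ^ 8 / β ^ 2 + h ^ 12 * s ^ 6 + h ^ 8 * s ^ 8) ≤ h ^ 4 / β + h ^ 6 * s ^ 3 + h ^ 4 * s ^ 4 := by
  have e1 : h ^ 8 / β ^ 2 = (h ^ 4 / β) ^ 2 := by field_simp
  have e2 : h ^ 12 * s ^ 6 = (h ^ 6 * s ^ 3) ^ 2 := by ring
  have e3 : h ^ 8 * s ^ 8 = (h ^ 4 * s ^ 4) ^ 2 := by ring
  rw [e1, e2, e3]
  refine (sqrt_add_three_le' (sq_nonneg _) (sq_nonneg _) (sq_nonneg _)).trans (le_of_eq ?_)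
  rw [Real.sqrt_sq (by positivity), Real.sqrt_sq (by positivity), Real.sqrt_sq (by positivity), add_assoc]

/-- `√(H⁴/β + H¹²s⁶ + H⁸s⁸) ≤ H²/√β + H⁶s³ + H⁴s⁴` (`H, s ≥ 0`, `β > 0`). -/
theorem sqrt_X4_le {h s β : ℝ} (_hh : 0 ≤ h) (_hs : 0 ≤ s) (hβ : 0 < β) :
    Real.sqrt (h ^ 4 / β + h ^ 12 * s ^ 6 + h ^ 8 * s ^ 8) ≤ h ^ 2 / Real.sqrt β + h ^ 6 * s ^ 3 + h ^ 4 * s ^ 4 := by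
  have hsb : 0 < Real.sqrt β := Real.sqrt_pos.2 hβ
  have e1 : h ^ 4 / β = (h ^ 2 / Real.sqrt β) ^ 2 := by
    rw [div_pow, Real.sq_sqrt hβ.le]; ring
  have e2 : h ^ 12 * s ^ 6 = (h ^ 6 * s ^ 3) ^ 2 := by ring
  have e3 : h ^ 8 * s ^ 8 = (h ^ 4 * s ^ 4) ^ 2 := by ring
  rw [e1, e2, e3]
  refine (sqrt_add_three_le' (sq_nonneg _) (sq_nonneg _) (sq_nonneg _)).trans (le_of_eq ?_)
  rw [Real.sqrt_sq (by positivity), Real.sqrt_sq (by positivity), Real.sqrt_sq (by positivity), add_assoc]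

end GaussNormalForm

/-! ## §2 Two small `μ_D` facts -/

namespace GaussNormalForm

open EdgeChartGaussian (gaussAvg_nonneg integral_gaussWeight_pos)

variable {H : ℕ} {β : ℝ}

/-- `E_0[Y] ≥ 0` for `Y ≥ 0` (over `μ_D`). -/
theorem tiltExp_muD_zero_nonneg (hβ : 0 < β) (s : ℝ) (U : (LandauFree H → E3) → ℝ) {Y : (LandauFree H → E3) → ℝ} (hY : ∀ a, 0 ≤ Y a) :
    0 ≤ Tilt.tiltExp (((volume : Measure (LandauFree H → E3)).restrict (smallField H s)).withDensity fun a => ENNReal.ofReal (gaussWeight β H a)) U 0 Y := by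
  rw [Tilt.tiltExp_muD_zero_eq H hβ s U Y]
  exact div_nonneg (gaussAvg_nonneg H hβ fun a => mul_nonneg (by unfold sfInd; exact Set.indicator_nonneg (fun _ _ => zero_le_one) _) (hY a))
    (gaussAvg_nonneg H hβ fun a => by unfold sfInd; exact Set.indicator_nonneg (fun _ _ => zero_le_one) _)

/-- `1/2 ≤ E₀[1_D]` ⇒ `0 < ∫ 1_D·gaussWeight` (the non-degeneracy hypothesis of LEAD's (e4) bound). -/
theorem integral_sfInd_mul_gaussWeight_pos_of_half_le (hβ : 0 < β) {s : ℝ} (hD : 1 / 2 ≤ gaussAvg β H (sfInd H s)) :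
    0 < ∫ a : LandauFree H → E3, sfInd H s a * gaussWeight β H a := by
  have hZ := integral_gaussWeight_pos H hβ
  have h : gaussAvg β H (sfInd H s) * ∫ a : LandauFree H → E3, gaussWeight β H a = ∫ a, sfInd H s a * gaussWeight β H a := by
    unfold gaussAvg; rw [div_mul_cancel₀ _ hZ.ne']
  rw [← h]
  exact mul_pos (lt_of_lt_of_le (by norm_num) hD) hZ

/-! ## §3 (e4) packaged -/

/-- ★★ **T-S5.13K-K3 — `κ₃,₀` in closed form, the four T-products kept separate.**  There are `C_E, C_O, C_U ≥ 0`, `c₀ > 0`, `m` such that for `H ≥ 1`,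
`β ≥ H⁴`, `0 < s ≤ 1`, `s·H² ≤ c₀`, `E₀[1_{smallField H s}] ≥ 1/2` and all base points `x, y`, with `L = 1 + log H`, `R = √(C_U·L^m)`, `a_E = √C_E·L²/β²`,
`a_O = √C_O·s³/(β√β)`, `P₈ = H⁴/β + H⁶s³ + H⁴s⁴`, `P₄ = H²/√β + H⁶s³ + H⁴s⁴`:
`|κ₃,₀(c_x, c_y, tiltU)| ≤ a_E·R·P₈ + √(a_E·a_O)·R·P₄ + √(a_O·a_E)·R·P₄ + a_O·R·P₈`  (= T(Ẽ,Ẽ,Ũe) + T(Ẽ,O,Uo) + T(O,Ẽ,Uo) + T(O,O,Ũe) of ✓p744941). -/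
theorem abs_tiltCum3_muD_zero_chartPlaqCost_le_sizes :
    ∃ CE CO CU c₀ : ℝ, ∃ m : ℕ, 0 ≤ CE ∧ 0 ≤ CO ∧ 0 ≤ CU ∧ 0 < c₀ ∧ ∀ H : ℕ, 1 ≤ H → ∀ β : ℝ, (H : ℝ) ^ 4 ≤ β →
      ∀ s : ℝ, 0 < s → s ≤ 1 → s * (H : ℝ) ^ 2 ≤ c₀ → 1 / 2 ≤ gaussAvg β H (sfInd H s) → ∀ x y : Site 4,
        |Tilt.tiltCum3 (((volume : Measure (LandauFree H → E3)).restrict (smallField H s)).withDensity fun a => ENNReal.ofReal (gaussWeight β H a))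
            (tiltU β H) 0 (chartPlaqCost H x 1 2) (chartPlaqCost H y 1 2)| ≤
          Real.sqrt CE * (1 + Real.log H) ^ 2 / β ^ 2 * Real.sqrt (CU * (1 + Real.log H) ^ m) *
              ((H : ℝ) ^ 4 / β + (H : ℝ) ^ 6 * s ^ 3 + (H : ℝ) ^ 4 * s ^ 4) +
            Real.sqrt (Real.sqrt CE * (1 + Real.log H) ^ 2 / β ^ 2 * (Real.sqrt CO * s ^ 3 / (β * Real.sqrt β))) * Real.sqrt (CU * (1 + Real.log H) ^ m) *
              ((H : ℝ) ^ 2 / Real.sqrt β + (H : ℝ) ^ 6 * s ^ 3 + (H : ℝ) ^ 4 * s ^ 4) +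
            Real.sqrt (Real.sqrt CO * s ^ 3 / (β * Real.sqrt β) * (Real.sqrt CE * (1 + Real.log H) ^ 2 / β ^ 2)) * Real.sqrt (CU * (1 + Real.log H) ^ m) *
              ((H : ℝ) ^ 2 / Real.sqrt β + (H : ℝ) ^ 6 * s ^ 3 + (H : ℝ) ^ 4 * s ^ 4) +
            Real.sqrt CO * s ^ 3 / (β * Real.sqrt β) * Real.sqrt (CU * (1 + Real.log H) ^ m) *
              ((H : ℝ) ^ 4 / β + (H : ℝ) ^ 6 * s ^ 3 + (H : ℝ) ^ 4 * s ^ 4) := by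
  obtain ⟨CS, hCS0, hS⟩ := Tilt.tiltExp_muD_zero_plaqCost_slots_le
  obtain ⟨CU, cU, m, hcU, hU⟩ := tiltExp_muD_zero_tiltU_slots_le
  obtain ⟨CT, cT, mT, hcT, hT⟩ := TiltSup.abs_tiltU_le
  refine ⟨CS, CS, max CU 0, min cU cT, m, hCS0, hCS0, le_max_right _ _, lt_min hcU hcT, fun H hH β hβ s hs0 hs1 hsH hD x y => ?_⟩
  have hH' : (1 : ℝ) ≤ H := by exact_mod_cast hH
  have hH0 : (0 : ℝ) ≤ H := by positivity
  have hβ1 : 1 ≤ β := le_trans (by nlinarith [one_le_pow₀ (M₀ := ℝ) hH' (n := 4)]) hβ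
  have hβpos : 0 < β := by linarith
  have hlog : 0 ≤ Real.log H := Real.log_nonneg hH'
  have hsU : s * (H : ℝ) ^ 2 ≤ cU := hsH.trans (min_le_left _ _)
  have hsT : s * (H : ℝ) ^ 2 ≤ cT := hsH.trans (min_le_right _ _)
  -- the bound `B` on `D` for LEAD's hypothesis
  set B : ℝ := max 8 (CT * (1 + Real.log H) ^ mT * (|β| * (H : ℝ) ^ 4 * s ^ 3 + (H : ℝ) ^ 6 * s ^ 2)) with hB
  have hB8 : 8 ≤ B := le_max_left _ _
  have hUB : ∀ a ∈ smallField H s, |tiltU β H a| ≤ B := fun a ha => (hT H hH β s hs0.le hs1 hsT a ha).trans (le_max_right _ _)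
  have hDpos := integral_sfInd_mul_gaussWeight_pos_of_half_le hβpos hD
  -- LEAD's four-T bound
  have hmain := Tilt.abs_tiltCum3_muD_zero_chartPlaqCost_le H hβpos s hDpos x y hB8 hUB
  simp only at hmain
  -- the slot bounds
  obtain ⟨hE1, -, hO1⟩ := hS H hH β hβ1 s hs0 hs1 x hD (tiltU β H)
  obtain ⟨hE2, -, hO2⟩ := hS H hH β hβ1 s hs0 hs1 y hD (tiltU β H)
  obtain ⟨hZe, hZo, -⟩ := hU H hH β hβ s hs0 hs1 hsU hD
  set AE : ℝ := CS * (1 + Real.log H) ^ 4 / β ^ 4 with hAE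
  set AO : ℝ := CS * s ^ 6 / β ^ 3 with hAO
  set X8 : ℝ := (H : ℝ) ^ 8 / β ^ 2 + (H : ℝ) ^ 12 * s ^ 6 + (H : ℝ) ^ 8 * s ^ 8 with hX8
  set X4 : ℝ := (H : ℝ) ^ 4 / β + (H : ℝ) ^ 12 * s ^ 6 + (H : ℝ) ^ 8 * s ^ 8 with hX4
  have hX80 : 0 ≤ X8 := by positivity
  have hX40 : 0 ≤ X4 := by positivity
  have hLm0 : 0 ≤ (1 + Real.log (H : ℝ)) ^ m := pow_nonneg (by linarith) _
  have hZe' : Tilt.tiltExp (((volume : Measure (LandauFree H → E3)).restrict (smallField H s)).withDensity fun a => ENNReal.ofReal (gaussWeight β H a))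
      (tiltU β H) 0 (fun a => ((tiltU β H a + tiltU β H (-a)) / 2 -
        Tilt.tiltExp (((volume : Measure (LandauFree H → E3)).restrict (smallField H s)).withDensity fun a => ENNReal.ofReal (gaussWeight β H a)) (tiltU β H) 0
          (fun a => (tiltU β H a + tiltU β H (-a)) / 2)) ^ 2) ≤ max CU 0 * (1 + Real.log H) ^ m * X8 :=
    hZe.trans (mul_le_mul_of_nonneg_right (mul_le_mul_of_nonneg_right (le_max_left _ _) hLm0) hX80)
  have hZo' : Tilt.tiltExp (((volume : Measure (LandauFree H → E3)).restrict (smallField H s)).withDensity fun a => ENNReal.ofReal (gaussWeight β H a))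
      (tiltU β H) 0 (fun a => ((tiltU β H a - tiltU β H (-a)) / 2) ^ 2) ≤ max CU 0 * (1 + Real.log H) ^ m * X4 :=
    hZo.trans (mul_le_mul_of_nonneg_right (mul_le_mul_of_nonneg_right (le_max_left _ _) hLm0) hX40)
  set Ze : ℝ := max CU 0 * (1 + Real.log H) ^ m * X8 with hZedef
  set Zo : ℝ := max CU 0 * (1 + Real.log H) ^ m * X4 with hZodef
  -- nonnegativity of the six distinct moments
  have n1 := tiltExp_muD_zero_nonneg hβpos s (tiltU β H) (Y := fun a => (chartPlaqCost H x 1 2 a - chartPlaqCostOdd H x 1 2 a -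
    Tilt.tiltExp (((volume : Measure (LandauFree H → E3)).restrict (smallField H s)).withDensity fun a => ENNReal.ofReal (gaussWeight β H a)) (tiltU β H) 0
      (fun a => chartPlaqCost H x 1 2 a - chartPlaqCostOdd H x 1 2 a)) ^ 4) (fun a => by positivity)
  have n2 := tiltExp_muD_zero_nonneg hβpos s (tiltU β H) (Y := fun a => (chartPlaqCost H y 1 2 a - chartPlaqCostOdd H y 1 2 a -
    Tilt.tiltExp (((volume : Measure (LandauFree H → E3)).restrict (smallField H s)).withDensity fun a => ENNReal.ofReal (gaussWeight β H a)) (tiltU β H) 0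
      (fun a => chartPlaqCost H y 1 2 a - chartPlaqCostOdd H y 1 2 a)) ^ 4) (fun a => by positivity)
  have n3 := tiltExp_muD_zero_nonneg hβpos s (tiltU β H) (Y := fun a => chartPlaqCostOdd H x 1 2 a ^ 4) (fun a => by positivity)
  have n4 := tiltExp_muD_zero_nonneg hβpos s (tiltU β H) (Y := fun a => chartPlaqCostOdd H y 1 2 a ^ 4) (fun a => by positivity)
  have n5 := tiltExp_muD_zero_nonneg hβpos s (tiltU β H) (Y := fun a => ((tiltU β H a + tiltU β H (-a)) / 2 -
    Tilt.tiltExp (((volume : Measure (LandauFree H → E3)).restrict (smallField H s)).withDensity fun a => ENNReal.ofReal (gaussWeight β H a)) (tiltU β H) 0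
      (fun a => (tiltU β H a + tiltU β H (-a)) / 2)) ^ 2) (fun a => by positivity)
  have n6 := tiltExp_muD_zero_nonneg hβpos s (tiltU β H) (Y := fun a => ((tiltU β H a - tiltU β H (-a)) / 2) ^ 2) (fun a => by positivity)
  -- the four T's
  have t1 := T_mono n1 hE1 n2 hE2 n5 hZe'
  have t2 := T_mono n1 hE1 n4 hO2 n6 hZo'
  have t3 := T_mono n3 hO1 n2 hE2 n6 hZo'
  have t4 := T_mono n3 hO1 n4 hO2 n5 hZe'
  have hAE0 : 0 ≤ AE := by positivity
  have hAO0 : 0 ≤ AO := by positivity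
  -- collapse the symmetric square roots and substitute the closed forms
  have e1 : Real.sqrt (Real.sqrt AE * Real.sqrt AE) = Real.sqrt AE := sqrt_sqrt_mul_self hAE0
  have e4 : Real.sqrt (Real.sqrt AO * Real.sqrt AO) = Real.sqrt AO := sqrt_sqrt_mul_self hAO0
  have sAE : Real.sqrt AE = Real.sqrt CS * (1 + Real.log H) ^ 2 / β ^ 2 := by
    rw [hAE, show (1 + Real.log (H : ℝ)) ^ 4 = ((1 + Real.log (H : ℝ)) ^ 1) ^ 4 by ring, sqrt_const_mul_pow_four_div hCS0 (by linarith) hβpos]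
    ring
  have sAO : Real.sqrt AO = Real.sqrt CS * s ^ 3 / (β * Real.sqrt β) := sqrt_const_mul_pow_six_div_cube hCS0 hs0.le hβpos
  have sZe : Real.sqrt Ze ≤ Real.sqrt (max CU 0 * (1 + Real.log H) ^ m) * ((H : ℝ) ^ 4 / β + (H : ℝ) ^ 6 * s ^ 3 + (H : ℝ) ^ 4 * s ^ 4) := by
    rw [hZedef, Real.sqrt_mul (by positivity)]
    exact mul_le_mul_of_nonneg_left (sqrt_X8_le hH0 hs0.le hβpos) (Real.sqrt_nonneg _)
  have sZo : Real.sqrt Zo ≤ Real.sqrt (max CU 0 * (1 + Real.log H) ^ m) * ((H : ℝ) ^ 2 / Real.sqrt β + (H : ℝ) ^ 6 * s ^ 3 + (H : ℝ) ^ 4 * s ^ 4) := by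
    rw [hZodef, Real.sqrt_mul (by positivity)]
    exact mul_le_mul_of_nonneg_left (sqrt_X4_le hH0 hs0.le hβpos) (Real.sqrt_nonneg _)
  have g1 : 0 ≤ Real.sqrt (Real.sqrt AE * Real.sqrt AE) := Real.sqrt_nonneg _
  have g2 : 0 ≤ Real.sqrt (Real.sqrt AE * Real.sqrt AO) := Real.sqrt_nonneg _
  have g3 : 0 ≤ Real.sqrt (Real.sqrt AO * Real.sqrt AE) := Real.sqrt_nonneg _
  have g4 : 0 ≤ Real.sqrt (Real.sqrt AO * Real.sqrt AO) := Real.sqrt_nonneg _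
  calc _ ≤ _ := hmain
    _ ≤ Real.sqrt (Real.sqrt AE * Real.sqrt AE) * Real.sqrt Ze + Real.sqrt (Real.sqrt AE * Real.sqrt AO) * Real.sqrt Zo +
          Real.sqrt (Real.sqrt AO * Real.sqrt AE) * Real.sqrt Zo + Real.sqrt (Real.sqrt AO * Real.sqrt AO) * Real.sqrt Ze :=
        add_le_add (add_le_add (add_le_add t1 t2) t3) t4
    _ ≤ Real.sqrt (Real.sqrt AE * Real.sqrt AE) * (Real.sqrt (max CU 0 * (1 + Real.log H) ^ m) * ((H : ℝ) ^ 4 / β + (H : ℝ) ^ 6 * s ^ 3 + (H : ℝ) ^ 4 * s ^ 4)) +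
          Real.sqrt (Real.sqrt AE * Real.sqrt AO) * (Real.sqrt (max CU 0 * (1 + Real.log H) ^ m) * ((H : ℝ) ^ 2 / Real.sqrt β + (H : ℝ) ^ 6 * s ^ 3 + (H : ℝ) ^ 4 * s ^ 4)) +
          Real.sqrt (Real.sqrt AO * Real.sqrt AE) * (Real.sqrt (max CU 0 * (1 + Real.log H) ^ m) * ((H : ℝ) ^ 2 / Real.sqrt β + (H : ℝ) ^ 6 * s ^ 3 + (H : ℝ) ^ 4 * s ^ 4)) +
          Real.sqrt (Real.sqrt AO * Real.sqrt AO) * (Real.sqrt (max CU 0 * (1 + Real.log H) ^ m) * ((H : ℝ) ^ 4 / β + (H : ℝ) ^ 6 * s ^ 3 + (H : ℝ) ^ 4 * s ^ 4)) :=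
        add_le_add (add_le_add (add_le_add (mul_le_mul_of_nonneg_left sZe g1) (mul_le_mul_of_nonneg_left sZo g2)) (mul_le_mul_of_nonneg_left sZo g3))
          (mul_le_mul_of_nonneg_left sZe g4)
    _ = _ := by rw [e1, e4, sAE, sAO]; ring

end GaussNormalForm

end Summit.QuantumFields.YangMills.Theorems.AllWindowsColdBoxBoxHighLine

end
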